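import Summits.QuantumFields.BalabanUV.Beta.GAN24.LayerTransportLiteralSocket
import Summits.QuantumFields.BalabanUV.Beta.GAN24.ChainTableLegTelescopeCell

/-!
# `BalabanUV.Beta.GAN24.LayerTransportLiteralSocketCoClosed` — binder row G-an2-4 ∕ (CONV-C), W-slot CT-W, route «WC-TL» ∕ (Q-R) «QR-LL», row **(LT-Δ) «LAYER TRANSPORT»**, part
# (LT-LIT)^{cc}: **ON A CO-CLOSED LETTER THE LITERAL's LAYER BOUND `hLT` NEEDS ONLY THE TWO KERNEL ONE-GAUGE CELLS, WITH THE UNDRESSED TABLE LEG** — the sibling, for the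
# CO-CLOSED class (`divV S ≡ 0`), of the OWNER gan24-p1 g30's flux-free socket `LayerTransportFluxFreeSocket` and the U-table form of his END's row (CC)
# (`WardRemainderEndThreeCoDress.exists_hLT_literal_of_kernel_cells_of_divFree`, p338371; leaf-01 g68 W-1 (ii), the OWNER: «YOURS as offered», journal l.46126)

NOT IN PRINT; OUR BOOKKEEPING ([folklore] composition BY NAME: leaf-01 g65 `LayerTransportLiteralSocket.exists_hLT_literal_of_gauge_cells` ⨾ leaf-01 g67
`ChainTableLegCoClosed.push₃_legChain_table_eq_of_divFree` (ANY kernel legs: on a co-closed letter the dressed chain of table legs IS the undressed composite column) ⨾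
`ChainTableLegTelescopeCell.biLoc_smul_push₃_chainGauge_of_divFree` (the table one-gauge cell is the zero kernel) ⨾ `CoDressedColumnPairing.summable_stencil_slot` (slot rows
summable from `LocStencil`); G-an2-4 formalisation swarm, leaf prover `b2b-balaban-gan24-formalise-leaf-01`, gen 68).  HONEST FRAMING (cell contract, verbatim): «discharging
`BetaPertH` makes Bałaban's UV stability UNCONDITIONAL — a real constructive-QFT result; it is NOT the continuum limit and NOT the Clay problem.»  HONEST DEPENDENCY (verbatim):
«continuum YM on T⁴ ⇐ BetaPertH ∧ nine spine estimates (0/9 proved); BetaPertH ⇐ (D1) ∧ (D4) ∧ CAP+tail; G-an2-4 gates asym, D1 and NE2/3/4.»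

## What (`d = 3`, `2 ≤ Lc`, in-block root `toSite rr`; `T = legChain (respStepBmSeq ρ Lc) (m+1) k`, `U = respStep (Lc^(m+1)) (Lc^(m+1+k+1))`)
§1 `push₃_kernelCell_left_table_eq_of_divFree` ∕ `push₃_kernelCell_right_table_eq_of_divFree`: on a co-closed local letter the two KERNEL one-gauge cells of the literal socket
   carry the UNDRESSED table leg — `push₃ (T−U) T T S = push₃ (T−U) T U S`, `push₃ U (T−U) T S = push₃ U (T−U) U S` (g67's table identity at the legs `(T−U, T)` ∕ `(U, T−U)`).
§2 **`exists_hLT_literal_of_kernel_cells_undressedTable_of_divFree`**: `∃ κ₀ A A′ A″` (leaf-02's, level-free) such that for every `0 < κ ≤ κ₀`, every `(m, k)`, every CO-CLOSED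
   local letter `S` (`LocStencil S Csl m′`, `divV S ≡ 0`; NO separate slot-summability row — derived) meeting the letter-side rows of the (LT-3) END at `κ`, and ANY `K₁ K₂` with
   the KERNEL one-gauge cells `push₃ (T−U) T U S`, `push₃ U (T−U) U S` (UNDRESSED table leg; DISPLAYED — (ii-G)'s objects: `T` survives in kernel slots alone) bi-localised at `U₀`,
   the literal's cubic push `push₃ T T T S` satisfies the END's `hLT` with constant `(K₀ + K₁ + K₂)·(√(Lc^(k+1)))⁻¹·e^{−min(κ∕2,δ∕2)‖y−U₀‖₁}`, `K₀` = the (UUU) cell's explicit constant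
   (DISCHARGED inside the socket, `LayerTransportUndressedThree`).
K-LL-4′ (the two kernel cells) is NOT advanced — displayed; leaf-01 g68's located reading (journal, INTENT I-leaf01-g68-1 ∕ W-3): in the v-split END only depth `k = 0` sub-letters are
co-closed ∕ flux-free, and there `LayerTransportDepthZero` needs no cell.  [folklore]; 0 cited facts, 0 `def`, 0 `def … : Prop`, 0 sorry.  NOTHING of (Q-R)∕(LT)∕(LAY)∕(S)∕(DIV)∕(DL)
discharged; NEVER «G-an2-4 closed» as (CONV-C); NOT D1, NOT `BetaPertH`, NOT continuum, NOT Clay.  2026-08-22; no existing file touched.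
-/

noncomputable section

open Finset
open scoped BigOperators
open Literature.MathematicalPhysics.QuantumFieldTheory
open Literature.MathematicalPhysics.QuantumFieldTheory.Balaban1983to89
open Literature.MathematicalPhysics.QuantumFieldTheory.Balaban1983to89.Beta
open B12Sec2to5 (l1 l1_nonneg)
open B6BondElimination (unitVec)
open ExpKernelCalculus (MKer Site BiLoc Zl)
open KernelWard (divV)
open OneStepResolventKernel (Fib LocStencil)
open LatticeForm (quo)
open AffineAveraging (box toSite)
open BalabanCompositeJets (respStep)
open Summit.QuantumFields.BalabanUV.Beta.GAN24.Push4Iter (LegFam legChain)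
open Summit.QuantumFields.BalabanUV.Beta.GAN24.Push3 (push₃)
open Summit.QuantumFields.BalabanUV.Beta.GAN24.RespStepBmDecompExact (respStepBmSeq)
open Summit.QuantumFields.BalabanUV.Beta.GAN24.CoDressedColumnPairing (summable_stencil_slot)
open Summit.QuantumFields.BalabanUV.Beta.GAN24.LayerTransportLiteralSocket (exists_hLT_literal_of_gauge_cells)
open Summit.QuantumFields.BalabanUV.Beta.GAN24.ChainTableLegCoClosed (push₃_legChain_table_eq_of_divFree)
open Summit.QuantumFields.BalabanUV.Beta.GAN24.ChainTableLegTelescopeCell (biLoc_smul_push₃_chainGauge_of_divFree)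

namespace Summit.QuantumFields.BalabanUV.Beta.GAN24.LayerTransportLiteralSocketCoClosed

variable {d : ℕ} {Lc : ℕ} [NeZero Lc]

/-! ## §1 On a co-closed letter the two kernel one-gauge cells carry the undressed table leg -/

section Cells

variable {rr : Fin (d + 1) → ℕ} (hrr : rr ∈ box (d + 1) Lc) (m k : ℕ)
  {S : Fin (d + 1) → Site (d + 1) → MKer (d + 1) (Fib d)} {Csl m' : ℝ} (hSl : LocStencil S Csl m') (hm' : 0 < m')

include hrr hSl hm' in
/-- [folklore] (g67's `push₃_legChain_table_eq_of_divFree` at the legs `(T − U, T)`).  **THE LEFT KERNEL CELL CARRIES THE UNDRESSED TABLE LEG** on a co-closed local letter: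
`push₃ (T−U) T T S κ′ u′ = push₃ (T−U) T U S κ′ u′`. -/
theorem push₃_kernelCell_left_table_eq_of_divFree (hdiv : ∀ u, divV S u = 0) (κ' : Fin (d + 1)) (u' : Site (d + 1)) :
    push₃ (legChain (respStepBmSeq (d := d) (toSite rr) Lc) (m + 1) k - respStep (d := d) (Lc ^ (m + 1)) (Lc ^ (m + 1 + k + 1)))
        (legChain (respStepBmSeq (d := d) (toSite rr) Lc) (m + 1) k) (legChain (respStepBmSeq (d := d) (toSite rr) Lc) (m + 1) k) S κ' u'
      = push₃ (legChain (respStepBmSeq (d := d) (toSite rr) Lc) (m + 1) k - respStep (d := d) (Lc ^ (m + 1)) (Lc ^ (m + 1 + k + 1)))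
        (legChain (respStepBmSeq (d := d) (toSite rr) Lc) (m + 1) k) (respStep (d := d) (Lc ^ (m + 1)) (Lc ^ (m + 1 + k + 1))) S κ' u' :=
  push₃_legChain_table_eq_of_divFree hrr (m + 1) k (fun κ x z a b => summable_stencil_slot hSl hm' κ x z a b) hdiv _ _ κ' u'

include hrr hSl hm' in
/-- [folklore] **THE RIGHT KERNEL CELL CARRIES THE UNDRESSED TABLE LEG** on a co-closed local letter: `push₃ U (T−U) T S κ′ u′ = push₃ U (T−U) U S κ′ u′`. -/
theorem push₃_kernelCell_right_table_eq_of_divFree (hdiv : ∀ u, divV S u = 0) (κ' : Fin (d + 1)) (u' : Site (d + 1)) :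
    push₃ (respStep (d := d) (Lc ^ (m + 1)) (Lc ^ (m + 1 + k + 1)))
        (legChain (respStepBmSeq (d := d) (toSite rr) Lc) (m + 1) k - respStep (d := d) (Lc ^ (m + 1)) (Lc ^ (m + 1 + k + 1)))
        (legChain (respStepBmSeq (d := d) (toSite rr) Lc) (m + 1) k) S κ' u'
      = push₃ (respStep (d := d) (Lc ^ (m + 1)) (Lc ^ (m + 1 + k + 1)))
        (legChain (respStepBmSeq (d := d) (toSite rr) Lc) (m + 1) k - respStep (d := d) (Lc ^ (m + 1)) (Lc ^ (m + 1 + k + 1)))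
        (respStep (d := d) (Lc ^ (m + 1)) (Lc ^ (m + 1 + k + 1))) S κ' u' :=
  push₃_legChain_table_eq_of_divFree hrr (m + 1) k (fun κ x z a b => summable_stencil_slot hSl hm' κ x z a b) hdiv _ _ κ' u'

end Cells

/-! ## §2 The literal's `hLT` on a co-closed letter from the two U-table kernel cells -/

section Three

variable {Lc : ℕ} [NeZero Lc]

/-- NOT IN PRINT; OUR BOOKKEEPING (`LayerTransportLiteralSocket.exists_hLT_literal_of_gauge_cells` ⨾ §1 ⨾ `ChainTableLegTelescopeCell.biLoc_smul_push₃_chainGauge_of_divFree`).  **ROW (CC),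
U-TABLE FORM: THE CO-CLOSED LETTER's `hLT` FROM TWO KERNEL ONE-GAUGE CELLS WITH THE UNDRESSED TABLE LEG.**  `d = 3`, `2 ≤ Lc`: there are `κ₀ > 0`, `A A′ A″ ≥ 0` (leaf-02's,
level-free) such that for every `0 < κ ≤ κ₀`, every `(m, k)`, every CO-CLOSED local letter `S` (`LocStencil S Csl m′`, `divV S ≡ 0`) meeting the letter-side rows of the (LT-3) END
at `κ`, and ANY `K₁ K₂` with the KERNEL one-gauge cells `push₃ (T−U) T U S`, `push₃ U (T−U) U S` (UNDRESSED table leg `U = respStep (Lc^(m+1)) (Lc^(m+1+k+1))`; DISPLAYED)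
bi-localised at `U₀`, the literal's cubic push `push₃ T T T S` (`T = legChain (respStepBmSeq ρ Lc) (m+1) k`) satisfies the END's `hLT` with constant
`(K₀ + K₁ + K₂)·(√(Lc^(k+1)))⁻¹·e^{−min(κ∕2,δ∕2)‖y−U₀‖₁}` — the table cell is the zero kernel (g67), the (UUU) cell `K₀` is discharged inside the socket. -/
theorem exists_hLT_literal_of_kernel_cells_undressedTable_of_divFree (hLc : 2 ≤ Lc) {rr : Fin (3 + 1) → ℕ} (hrr : rr ∈ box (3 + 1) Lc) :
    ∃ κ₀ A A' A'' : ℝ, 0 < κ₀ ∧ 0 ≤ A ∧ 0 ≤ A' ∧ 0 ≤ A'' ∧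
      ∀ (m k : ℕ) (κ : ℝ), 0 < κ → κ ≤ κ₀ →
      ∀ (S : Fin (3 + 1) → (Fin (3 + 1) → ℤ) → MKer (3 + 1) (Fib 3)) (ω : (Fin (3 + 1) → ℤ) → ℝ)
        (Z : Fin (3 + 1) → Fin (3 + 1) → Fin (3 + 1) → (Fin (3 + 1) → ℤ) → (Fin (3 + 1) → ℤ) → ℝ) (T' : Finset (Fin (3 + 1) → ℤ))
        (Cs Csl m' δ B δZ ρ CT : ℝ), κ < m' → 0 < δ → 0 ≤ Cs → 0 ≤ B → 4 * κ < δZ →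
        LocStencil S Csl m' →
        (∀ u, divV S u = 0) →
        (∀ k' u x z a b, |S k' u x z a b| ≤ Cs * ω u * Real.exp (-m' * (l1 (x - u) + l1 (z - u)))) →
        ∀ (y : Fin (3 + 1) → ℤ),
        (∀ u, 0 ≤ ω u ∧ ω u ≤ ∑ μ : Fin (3 + 1),
          (∑ v ∈ ((box (3 + 1) (Lc ^ (k + 1))).filter (fun v => v μ = Lc ^ (k + 1) - 1)).image (fun v => ((Lc ^ (k + 1) : ℕ) : ℤ) • y + toSite v),
              Real.exp (-δ * l1 (v - u))
            + ∑ v ∈ ((box (3 + 1) (Lc ^ (k + 1))).filter (fun v => v μ = 0)).image (fun v => ((Lc ^ (k + 1) : ℕ) : ℤ) • y + toSite v - unitVec μ),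
                Real.exp (-δ * l1 (v - u)))) →
        (∀ k' κ₁ κ₂ u, ∑' x, ∑' z, S k' u x z (Sum.inl κ₁) (Sum.inl κ₂) = ∑ y' ∈ T', Z k' κ₁ κ₂ y' u) →
        (∀ k' κ₁ κ₂, ∀ y' ∈ T', ∀ e, |Z k' κ₁ κ₂ y' e| ≤ B * Real.exp (-δZ * l1 (e - y'))) →
        (∀ k' κ₁ κ₂, ∀ y' ∈ T', ∑' e, Z k' κ₁ κ₂ y' e = 0) →
        (∀ k' κ₁ κ₂, ∀ y' ∈ T', ∀ i : Fin (3 + 1), ∑' e, (((e - y') i : ℤ) : ℝ) * Z k' κ₁ κ₂ y' e = 0) →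
        (∀ y' ∈ T', l1 (quo (Lc ^ (k + 1)) y' - y) ≤ ρ) → ((T'.card : ℝ) ≤ CT * (((Lc ^ (k + 1) : ℕ) : ℝ)) ^ (3 + 1)) →
        ∀ (K₁ K₂ : ℝ) (ν : Fin (3 + 1)) (U₀ : Fin (3 + 1) → ℤ),
        -- the two KERNEL one-gauge cells, UNDRESSED table leg
        BiLoc (((((Lc ^ (k + 1) : ℕ) : ℝ)) ^ (3 * (3 + 1))) •
            push₃ (legChain (respStepBmSeq (d := 3) (toSite rr) Lc) (m + 1) k - respStep (d := 3) (Lc ^ (m + 1)) (Lc ^ (m + 1 + k + 1)))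
              (legChain (respStepBmSeq (d := 3) (toSite rr) Lc) (m + 1) k) (respStep (d := 3) (Lc ^ (m + 1)) (Lc ^ (m + 1 + k + 1))) S ν U₀) U₀ U₀
          (K₁ * ((Real.sqrt (((Lc ^ (k + 1) : ℕ) : ℝ)))⁻¹ * Real.exp (-(min (κ / 2) (δ / 2)) * l1 (y - U₀)))) (κ / 4) →
        BiLoc (((((Lc ^ (k + 1) : ℕ) : ℝ)) ^ (3 * (3 + 1))) •
            push₃ (respStep (d := 3) (Lc ^ (m + 1)) (Lc ^ (m + 1 + k + 1)))
              (legChain (respStepBmSeq (d := 3) (toSite rr) Lc) (m + 1) k - respStep (d := 3) (Lc ^ (m + 1)) (Lc ^ (m + 1 + k + 1)))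
              (respStep (d := 3) (Lc ^ (m + 1)) (Lc ^ (m + 1 + k + 1))) S ν U₀) U₀ U₀
          (K₂ * ((Real.sqrt (((Lc ^ (k + 1) : ℕ) : ℝ)))⁻¹ * Real.exp (-(min (κ / 2) (δ / 2)) * l1 (y - U₀)))) (κ / 4) →
        BiLoc (((((Lc ^ (k + 1) : ℕ) : ℝ)) ^ (3 * (3 + 1))) •
            push₃ (legChain (respStepBmSeq (d := 3) (toSite rr) Lc) (m + 1) k) (legChain (respStepBmSeq (d := 3) (toSite rr) Lc) (m + 1) k)
              (legChain (respStepBmSeq (d := 3) (toSite rr) Lc) (m + 1) k) S ν U₀) U₀ U₀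
          (((((((3 : ℝ) + 1) ^ 3 * A ^ 2 * A' * Cs * (2 / (m' - κ) * Zl (3 + 1) ((m' - κ) / 2)) * (Zl (3 + 1) (m' - κ) + Zl (3 + 1) m'))
            * ((2 * ((3 : ℝ) + 1)) ^ 2 * Zl (3 + 1) (δ / 2) * Real.exp (min (κ / 2) (δ / 2))))
        + ((3 : ℝ) + 1) ^ 3 *
          ((((A'' * A * A + 2 * A' * A' * A + A * A'' * A) * Real.exp (2 * κ) + 2 * ((A' * A + A * A') * Real.exp κ) * A' + A * A * A'')
              * Real.exp (2 * (2 * κ))) * B * (8 / (δZ - 2 * (2 * κ)) ^ 2 * Zl (3 + 1) ((δZ - 2 * (2 * κ)) / 4)) * Real.exp ((κ / 2) * ρ) * CT))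
            + K₁ + K₂) * ((Real.sqrt (((Lc ^ (k + 1) : ℕ) : ℝ)))⁻¹ * Real.exp (-(min (κ / 2) (δ / 2)) * l1 (y - U₀)))) (κ / 4) := by
  obtain ⟨κ₀, A, A', A'', hκ₀, hA, hA', hA'', h⟩ := exists_hLT_literal_of_gauge_cells (Lc := Lc) hLc hrr
  refine ⟨κ₀, A, A', A'', hκ₀, hA, hA', hA'', ?_⟩
  intro m k κ hκ hκκ₀ S ω Z T' Cs Csl m' δ B δZ ρ CT hm hδ hCs hB hκδZ hSl hdiv hS y hω hQ hZ hM0 hP1 hTl hTcard K₁ K₂ ν U₀ h₁ h₂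
  have hm' : 0 < m' := hκ.trans hm
  have hSs : ∀ κ₁ x z a b, Summable fun u => S κ₁ u x z a b := fun κ₁ x z a b => summable_stencil_slot hSl hm' κ₁ x z a b
  -- the two kernel cells with the DRESSED table leg are the displayed U-table cells (§1)
  have h₁' : BiLoc (((((Lc ^ (k + 1) : ℕ) : ℝ)) ^ (3 * (3 + 1))) •
      push₃ (legChain (respStepBmSeq (d := 3) (toSite rr) Lc) (m + 1) k - respStep (d := 3) (Lc ^ (m + 1)) (Lc ^ (m + 1 + k + 1)))
        (legChain (respStepBmSeq (d := 3) (toSite rr) Lc) (m + 1) k) (legChain (respStepBmSeq (d := 3) (toSite rr) Lc) (m + 1) k) S ν U₀) U₀ U₀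
      (K₁ * ((Real.sqrt (((Lc ^ (k + 1) : ℕ) : ℝ)))⁻¹ * Real.exp (-(min (κ / 2) (δ / 2)) * l1 (y - U₀)))) (κ / 4) := by
    rw [push₃_kernelCell_left_table_eq_of_divFree hrr m k hSl hm' hdiv ν U₀]; exact h₁
  have h₂' : BiLoc (((((Lc ^ (k + 1) : ℕ) : ℝ)) ^ (3 * (3 + 1))) •
      push₃ (respStep (d := 3) (Lc ^ (m + 1)) (Lc ^ (m + 1 + k + 1)))
        (legChain (respStepBmSeq (d := 3) (toSite rr) Lc) (m + 1) k - respStep (d := 3) (Lc ^ (m + 1)) (Lc ^ (m + 1 + k + 1)))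
        (legChain (respStepBmSeq (d := 3) (toSite rr) Lc) (m + 1) k) S ν U₀) U₀ U₀
      (K₂ * ((Real.sqrt (((Lc ^ (k + 1) : ℕ) : ℝ)))⁻¹ * Real.exp (-(min (κ / 2) (δ / 2)) * l1 (y - U₀)))) (κ / 4) := by
    rw [push₃_kernelCell_right_table_eq_of_divFree hrr m k hSl hm' hdiv ν U₀]; exact h₂
  -- the table one-gauge cell is the zero kernel (g67)
  have h₃ := biLoc_smul_push₃_chainGauge_of_divFree (d := 3) hrr (m + 1) k hSs hdiv
    (respStep (d := 3) (Lc ^ (m + 1)) (Lc ^ (m + 1 + k + 1))) (respStep (d := 3) (Lc ^ (m + 1)) (Lc ^ (m + 1 + k + 1)))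
    (((((Lc ^ (k + 1) : ℕ) : ℝ)) ^ (3 * (3 + 1)))) ν U₀ U₀ U₀
    (((Real.sqrt (((Lc ^ (k + 1) : ℕ) : ℝ)))⁻¹ * Real.exp (-(min (κ / 2) (δ / 2)) * l1 (y - U₀)))) (κ / 4)
  have hmain := h m k κ hκ hκκ₀ S ω Z T' Cs Csl m' δ B δZ ρ CT hm hδ hCs hB hκδZ hSl hS y hω hQ hZ hM0 hP1 hTl hTcard K₁ K₂ 0 ν U₀ h₁' h₂' h₃
  refine StepJetData.biLoc_weaken hmain (le_of_eq ?_) le_rfl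
  ring

end Three

end Summit.QuantumFields.BalabanUV.Beta.GAN24.LayerTransportLiteralSocketCoClosed

end
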